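import Literature.MathematicalPhysics.QuantumFieldTheory.Balaban1983to89.B9Eq3105DirichletBondLettersAtOneY

/-!
# `Balaban1983to89.B9DirichletBondCubePairY` — [Balaban1985BackgroundPropagators] p. 409 l. 1–5 ∕ (3.105) p. 414: THE DIRICHLET BOND-SECTOR INVERSE
# `G_□(U)` OF THE CUBE SEQUENCE `{Ω_n(□)}` KEYED ON THE SEQUENCE's OWN AVERAGING PAIR `Q_□(U) ∕ Q*_□(U)` (letter (C)), ITS LAWS, THE LOCAL-INVERSE
# RELATION IN THE MEMBER's LETTER FROM ROW ∕ COLUMN AGREEMENT, (3.105) AND ITS TRANSPOSE AT THIS LETTER, AND THE `U = 1` FACE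

T. Bałaban, *Propagators for lattice gauge theories in a background field*, Commun. Math. Phys. **99** (1985) 389–434 [Balaban1985BackgroundPropagators] = [B9]:
p. 408 l. −14 ff. («Let us take a cube □ ∈ 𝒟_j, and let us define a sequence {Ω_n(□)}_{n=0,…,j+1} of domains …»), p. 409 l. 1–5 («The operators constructed
for this sequence, which we denote by G′_□(U), C_□(U) = (Q′(U)G′_□²(U)Q′*(U))⁻¹, G_□(U), satisfy all the inequalities of Theorems 3.1–3.3 correspondingly»),
(3.12)–(3.14) pp. 392–393 (the averaging operators `Q(U)`, `Q*(U)` of a sequence), (3.26)–(3.27) p. 395 («Δ_a(U) = Δ(U) + D_UR(U)D*_U + Q*(U)aQ(U) …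
G(U) = Δ_a(U)⁻¹»), p. 394 l. 24–33 (the Dirichlet convention `Ω₀ΔΩ₀`), (3.87)–(3.88) p. 409, (3.101) ∕ (3.104) ∕ (3.105) p. 414 («Δ_aG₀ = I − Σ_□K(h_□)G_□h_□
− Σ_□(1 − ζ_□̃)DPD*h_□G_□h_□ − Σ_□ζ_□̃(DPD* − DP_□D*)h_□G_□h_□ − Σ_□ζ_□̃P_{□,1}(∂h_□)G_□h_□ = I − R»), p. 395 («It coincides with Δ_a in (2.19) if U = 1»),
Cor. 3.5 p. 407; T. Bałaban, *Propagators and renormalization transformations for lattice gauge theories. II*, Commun. Math. Phys. **96** (1984) 223–250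
[Balaban1984PropagatorsII]: (2.3) p. 224, (2.19)–(2.20) pp. 226–227.

WHY THIS FILE (seat dag-n06-d g34; dag-n06-c g33's DESIGN WORD LOCATED-34 and this seat's ANSWER, bus 2026-08-31).  node00-def-Y's Dirichlet bond letter
✓`Node00.OpsYCubeDirInverseBond.GDirBY i 𝔮 𝔮⋆ Pl B = dirInv_{𝟙_B}(Δ_loc[𝔮] − Pl)` is keyed on a MEMBER-indexed averaging pair `𝔮 : QLetterY 𝔸 i`
(coarse index bonds `IBondY i` of the member's sequence `{Ω_j}`); the N06 heads (✓«KE₁₇X-Aγ») display it at the member's knit pair of record with the cube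
sequence's projection term `DP_□D*` — a hybrid (M).  Print builds `G_□(U)` «for this sequence» `{Ω_n(□)}` (p. 409 l. 1–5): its averaging term `Q*_□(U)a_□Q_□(U)`
lives on the CUBE sequence's index bonds `IBondCubeY i □` (r05's carriers, `B9CubeLettersBondOpsL0`).  This file is the cube-pair twin of def-Y's §3:
* §1 the type of a cube-indexed averaging pair `QCLetterY ∕ QCsLetterY`, the local part `Δ_{loc,□}[𝔮_□](U) := Δ(U) + D_UD*_U + 𝔮⋆_□(U) a_□ 𝔮_□(U)`
  (`deltaLocCQY`; at r05's straight-contour pair `(QCubeY parB, QsCubeY parB)` it IS `B9Eq3105AtLetters.deltaLocCubeY` by `rfl`), and the ROW ∕ COLUMN AGREEMENT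
  bridges with the member's `Δ_loc[𝔮](U)` (`B9Eq3105OfLocalInverseQ.deltaLocQY`): the Hessian and `DD*` parts are the same operator, so `h·Δ_loc[𝔮] = h·Δ_{loc,□}[𝔮_□]`
  (resp. `Δ_loc[𝔮]·h = Δ_{loc,□}[𝔮_□]·h`) as soon as the averaging rows (resp. columns) agree on `supp h` — print's silent step behind (3.105) («Similarly for
  averaging operators», p. 414; r05 ✓`B9CubeBondRowAgreement` for the straight pairs);
* §2 ★★ the letter `GDirCY i □ 𝔮_□ 𝔮⋆_□ Pl B : BondOpY` (`= dirInv_{𝟙_B}(Δ_{loc,□}[𝔮_□] − Pl)`), its regime object `padDeltaLocCY`, the `dirInvY` laws as instances of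
  def-Y's §2 (support, vanishing off `B`, congruence, the inverse laws), ★ the local-inverse laws in its OWN letter and ★★ IN THE MEMBER's LETTER
  (`hloc_GDirCY_of_rows ∕ hlocT_GDirCY_of_cols` — literally the `hloc ∕ hlocT` hypotheses of ✓`B9Eq3105OfLocalInverseQ.eq3105Q(T)_hT_ofLocalInverse`), locality in `U`;
* §3 ★★★ (3.105) AND ITS TRANSPOSE AT THE MEMBER's `Δ_a[𝔮][G′](U)` WITH `G_□` AT THE CUBE PAIR (`eq3105Q_hT_GDirCY ∕ eq3105QT_hT_GDirCY`): def-Y's exact-law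
  identities with `hloc ∕ hlocT` DISCHARGED from the regime and the row ∕ column agreement on `supp h_□` — the four printed families, no defect family;
* §4 the `U = 1` FACE at any pair with flat faces `𝔮_□(1) = q_□♯`, `𝔮⋆_□(1) = q*_□♯` (r05's kernels `qKc ∕ qsKc`): `Δ_{loc,□}[𝔮_□](1) = (deltaLocCubeMatY i □)♯`,
  `Δ_{loc,□}[𝔮_□](1) − DP_□(1)D* = (mlocDirCMatY i □ S K K_X)♯` (dag-n06-j ✓`B9Eq3105DirichletBondLettersAtOneY` §5 BY NAME), the regime and ★★ `G_□(1) = (𝟙_B K_B 𝟙_B)♯`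
  for any real `K_B` inverting the compression — the socket dag-n06-c's `U = 1` Dirichlet bond kernel rows (road (B5), [B6] Prop. 2.6) plug into.
The pair of record for the heads (the cube-indexed KNIT averaging `QknitCubeY`, whose rows agree with the member's knit letter `QknitY` on the hull) is the next file;
everything here is generic in the pair.

HONEST SCOPE.  Exact finite-dimensional algebra and bookkeeping over landed modules; NO inequality (Theorems 3.1–3.3 ∕ Cor. 3.6 for the sequence are the regime
HYPOTHESIS `IsUnit (padDeltaLocCY …)`, displayed, never proved here); the row ∕ column agreement is a HYPOTHESIS here (its geometric discharge at `supp h^T_□` is the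
row-agreement file); no choice of `B = Ω₀(□)` or `Pl_□` (binders).  Count-neutral (`--supports stmt-QuantumFields-27239`); N06 NOT discharged; one finite 𝕋⁴
programme at fixed `ε` — nothing continuum ∕ OS ∕ mass gap ∕ Clay; the Yang–Mills mass gap is NOT proved by any of this.  NEW file; nothing landed is modified;
no `sorry`, no `axiom`, no `instance`, no `notation`.  Net new unproved facts: 0 (four real `def`s + two type abbreviations, theorems).
-/

noncomputable section

namespace Literature.MathematicalPhysics.QuantumFieldTheory.Balaban1983to89.B9DirichletBondCubePairY

open Node00
open B6KLevelCensusIndexV1 (KIdx)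
open B6Cover236MultiLevelBlocks (cubes)
open B6MultiLevelTorusOperator (mlOpT)
open B9Thm31CubeLocalFlat (wCube)
open B9CubeLettersOpsL0 (cubeFamY)
open B9CubeLettersBondOpsL0 (BlkCubeY IBondCubeY QCubeY QsCubeY aCubeY qKc qsKc aKc QCubeY_one QsCubeY_one)
open B9Thm37CubeCoverCommutators (cutMulY cutMulY_apply hTY)
open B9Eq3104CutoffCommutators (hBdY hBdY_apply DPDsY)
open B9Eq3105OfLocalInverseQ (deltaLocQY KhBQY eq3105Q_hT_ofLocalInverse eq3105QT_hT_ofLocalInverse)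
open B9Eq3105AtLetters (deltaLocCubeY)
open B9Eq3105DirichletBondLettersAtOneY (xDirMatY pDirMatY deltaLocCubeMatY mlocDirCMatY deltaLocCubeY_one_liftMatY DPDsDirCubeY_one_liftMatY)
open B9Cor35AtOneInverseLetters (liftOpY_mul)
open Node00.OpsYNablaBridge (chartY)
open Node00.OpsYLocalInverse (dirPadY dirInvY dirInvY_congr)
open Node00.OpsYCubeDirInverse (indDiagY compr_mulVec_apply)
open Node00.OpsYCubeDirInverseBond (indProjY indProjY_apply indProjY_mul_dirInvY dirInvY_mul_indProjY dirInvY_apply_eq_zero dirInvY_apply_congr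
  dirInvY_of_not_isUnit' compr_mul_dirInvY' dirInvY_mul_compr' indProjY_mul_op_mul_dirInvY dirInvY_mul_op_mul_indProjY cutMulY_op_dirInvY_cutMulY
  cutMulY_dirInvY_op_cutMulY dirInvY_congr_of_apply dirPadY_congr_of_apply compr_congr_of_apply isUnit_dirPadY_indProjY_liftOpY dirInvY_indProjY_liftOpY)
open Node00.OpsYCubeProjectionG (insideBlkY DPDsDirCubeY)
open Node00.OpsYQLetter (QLetterY QsLetterY)
open scoped Matrix

variable {d ℓ : ℕ} {hd : 1 ≤ d + 1} {hL : Odd (ℓ + 1) ∧ 1 < ℓ + 1} {b₀ b₁ : ℝ}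
variable {𝔸 : Type} [NormedRing 𝔸] [NormedAlgebra ℂ 𝔸] [CompleteSpace 𝔸]

/-! ## §1 Cube-indexed averaging pairs, `Δ_{loc,□}[𝔮_□](U)`, and the row ∕ column agreement bridges with the member's `Δ_loc[𝔮](U)` -/

section Pair

variable (𝔸) in
/-- ★ **THE TYPE OF AN AVERAGING LETTER OF THE CUBE SEQUENCE** `U ↦ Q_□(U) : (fine-bond functions) → (functions on the index bonds of {Ω_n(□)})`, `ℂ`-linear at
each configuration — the cube twin of def-Y's `QLetterY`. [cite: Balaban1985BackgroundPropagators, (3.12)–(3.14) p.393, p.409 l.1–5] -/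
abbrev QCLetterY (i : KIdx d ℓ hd hL b₀ b₁) (q : ↥(cubes (toKT i).D.toDomains)) : Type :=
  CfgY 𝔸 i → ((FBondY i → 𝔸) →ₗ[ℂ] (IBondCubeY i q → 𝔸))

variable (𝔸) in
/-- the type of an adjoint averaging letter `U ↦ Q*_□(U)` of the cube sequence. [cite: Balaban1985BackgroundPropagators, (3.13) p.393, p.409 l.1–5] -/
abbrev QCsLetterY (i : KIdx d ℓ hd hL b₀ b₁) (q : ↥(cubes (toKT i).D.toDomains)) : Type :=
  CfgY 𝔸 i → ((IBondCubeY i q → 𝔸) →ₗ[ℂ] (FBondY i → 𝔸))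

variable (i : KIdx d ℓ hd hL b₀ b₁) (q : ↥(cubes (toKT i).D.toDomains))

/-- ★ **THE LOCAL PART OF THE CUBE SEQUENCE's `Δ_{a,□}(U)` AT A GENERIC CUBE PAIR**: `Δ_{loc,□}[𝔮_□](U) := Δ(U) + D_UD*_U + 𝔮⋆_□(U) a_□ 𝔮_□(U)` — r05's
`deltaLocCubeY` with the straight-contour pair replaced by `(𝔮_□, 𝔮⋆_□)`; `a_□ = aCubeY i □` (the weights of the cube sequence, (2.20)).
[cite: Balaban1985BackgroundPropagators, (3.26) p.395, p.409 l.1–5, p.414 («DRD* = DD* − DPD*»); Balaban1984PropagatorsII, (2.20) p.226] -/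
def deltaLocCQY (𝔮c : QCLetterY 𝔸 i q) (𝔮cs : QCsLetterY 𝔸 i q) (U : CfgY 𝔸 i) : (FBondY i → 𝔸) →ₗ[ℂ] (FBondY i → 𝔸) :=
  hessY i U + gradY i U ∘ₗ divY i U + 𝔮cs U ∘ₗ aCubeY i q ∘ₗ 𝔮c U

/-- the straight-contour face: at r05's pair `(QCubeY parB, QsCubeY parB)` the local part IS `B9Eq3105AtLetters.deltaLocCubeY` (definitionally).
[cite: Balaban1985BackgroundPropagators, (3.26) p.395, p.409 l.1–5, bookkeeping] -/
theorem deltaLocCQY_QCubeY (parB : BondParY 𝔸 i) : deltaLocCQY i q (QCubeY i q parB) (QsCubeY i q parB) = deltaLocCubeY i q parB := rfl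

/-- `Δ_{loc,□}[𝔮_□](U)`, evaluated. [cite: Balaban1985BackgroundPropagators, (3.26) p.395, bookkeeping] -/
theorem deltaLocCQY_apply (𝔮c : QCLetterY 𝔸 i q) (𝔮cs : QCsLetterY 𝔸 i q) (U : CfgY 𝔸 i) (A : FBondY i → 𝔸) (f : FBondY i) :
    deltaLocCQY i q 𝔮c 𝔮cs U A f = hessY i U A f + gradY i U (divY i U A) f + 𝔮cs U (aCubeY i q (𝔮c U A)) f := by
  simp only [deltaLocCQY, LinearMap.add_apply, Pi.add_apply, LinearMap.coe_comp, Function.comp_apply]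

/-- the member's `Δ_loc[𝔮](U)`, evaluated likewise. [cite: Balaban1985BackgroundPropagators, (3.26) p.395, bookkeeping] -/
theorem deltaLocQY_apply (𝔮 : QLetterY 𝔸 i) (𝔮s : QsLetterY 𝔸 i) (U : CfgY 𝔸 i) (A : FBondY i → 𝔸) (f : FBondY i) :
    deltaLocQY i 𝔮 𝔮s U A f = hessY i U A f + gradY i U (divY i U A) f + 𝔮s U (aY i (𝔮 U A)) f := by
  simp only [deltaLocQY, LinearMap.add_apply, Pi.add_apply, LinearMap.coe_comp, Function.comp_apply]

/-- the pointwise bridge: where the averaging entries agree, `(Δ_{loc,□}[𝔮_□](U)A)(f) = (Δ_loc[𝔮](U)A)(f)` (the Hessian and `DD*` parts are the same operator).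
[cite: Balaban1985BackgroundPropagators, (3.105) p.414 («Similarly for averaging operators»), (3.26) p.395] -/
theorem deltaLocCQY_apply_eq_of_entry (𝔮c : QCLetterY 𝔸 i q) (𝔮cs : QCsLetterY 𝔸 i q) (𝔮 : QLetterY 𝔸 i) (𝔮s : QsLetterY 𝔸 i) (U : CfgY 𝔸 i)
    (A : FBondY i → 𝔸) (f : FBondY i) (h : 𝔮cs U (aCubeY i q (𝔮c U A)) f = 𝔮s U (aY i (𝔮 U A)) f) :
    deltaLocCQY i q 𝔮c 𝔮cs U A f = deltaLocQY i 𝔮 𝔮s U A f := by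
  rw [deltaLocCQY_apply, deltaLocQY_apply, h]

/-- ★ **ROW AGREEMENT, OPERATOR FORM**: if the averaging rows of the member and of the cube sequence agree at every fine bond `f` with `h(f₋) ≠ 0`, then
`M_h·Δ_loc[𝔮](U) = M_h·Δ_{loc,□}[𝔮_□](U)` (`M_h` = multiplication by `h(b₋)`, print's (3.103) convention).
[cite: Balaban1985BackgroundPropagators, (3.105) p.414, (3.87) p.409, p.409 l.1–5] -/
theorem cutMulY_mul_deltaLocQY_eq_of_rows (𝔮c : QCLetterY 𝔸 i q) (𝔮cs : QCsLetterY 𝔸 i q) (𝔮 : QLetterY 𝔸 i) (𝔮s : QsLetterY 𝔸 i) (U : CfgY 𝔸 i)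
    (h : SiteY i → ℝ)
    (hrow : ∀ (A : FBondY i → 𝔸) (f : FBondY i), h (chartY i f.src) ≠ 0 → 𝔮s U (aY i (𝔮 U A)) f = 𝔮cs U (aCubeY i q (𝔮c U A)) f) :
    cutMulY (hBdY i h) * deltaLocQY i 𝔮 𝔮s U = cutMulY (hBdY i h) * deltaLocCQY i q 𝔮c 𝔮cs U := by
  refine LinearMap.ext fun A => funext fun f => ?_
  rw [Module.End.mul_apply, Module.End.mul_apply, cutMulY_apply, cutMulY_apply, hBdY_apply]
  by_cases hh : h (chartY i f.src) = 0
  · rw [hh, Complex.ofReal_zero, zero_smul, zero_smul]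
  · rw [deltaLocCQY_apply_eq_of_entry i q 𝔮c 𝔮cs 𝔮 𝔮s U A f (hrow A f hh).symm]

/-- ★ **COLUMN AGREEMENT, OPERATOR FORM**: if, on every vector field cut off by `h`, the averaging terms of the member and of the cube sequence agree
everywhere, then `Δ_loc[𝔮](U)·M_h = Δ_{loc,□}[𝔮_□](U)·M_h`. (transposed reading — bookkeeping)
[cite: Balaban1985BackgroundPropagators, (3.105) p.414, (3.87) p.409, p.409 l.1–5] -/
theorem deltaLocQY_mul_cutMulY_eq_of_cols (𝔮c : QCLetterY 𝔸 i q) (𝔮cs : QCsLetterY 𝔸 i q) (𝔮 : QLetterY 𝔸 i) (𝔮s : QsLetterY 𝔸 i) (U : CfgY 𝔸 i)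
    (h : SiteY i → ℝ)
    (hcol : ∀ (A : FBondY i → 𝔸) (f : FBondY i),
      𝔮s U (aY i (𝔮 U (cutMulY (hBdY i h) A))) f = 𝔮cs U (aCubeY i q (𝔮c U (cutMulY (hBdY i h) A))) f) :
    deltaLocQY i 𝔮 𝔮s U * cutMulY (hBdY i h) = deltaLocCQY i q 𝔮c 𝔮cs U * cutMulY (hBdY i h) := by
  refine LinearMap.ext fun A => funext fun f => ?_
  rw [Module.End.mul_apply, Module.End.mul_apply]
  exact (deltaLocCQY_apply_eq_of_entry i q 𝔮c 𝔮cs 𝔮 𝔮s U _ f (hcol A f).symm).symm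

end Pair

/-! ## §2 The Dirichlet bond-sector inverse `G_□(U)` of the cube sequence at a cube pair, and its laws -/

section Letter

variable (i : KIdx d ℓ hd hL b₀ b₁) (q : ↥(cubes (toKT i).D.toDomains))

/-- the PADDED COMPRESSION `Ω₀(Δ_{loc,□}[𝔮_□](U) − Pl_□(U))Ω₀ + (1 − Ω₀)` to the bond set `B` — the regime object (Theorems 3.1–3.3 ∕ Cor. 3.6 for the sequence,
displayed). [cite: Balaban1985BackgroundPropagators, p.409 l.1–5, Cor. 3.6 p.408, p.394] -/
def padDeltaLocCY (𝔮c : QCLetterY 𝔸 i q) (𝔮cs : QCsLetterY 𝔸 i q) (Pl : CfgY 𝔸 i → Module.End ℂ (FBondY i → 𝔸)) (B : Finset (FBondY i))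
    (U : CfgY 𝔸 i) : Module.End ℂ (FBondY i → 𝔸) :=
  dirPadY (indProjY B) (deltaLocCQY i q 𝔮c 𝔮cs U - Pl U)

/-- ★★ **THE DIRICHLET BOND-SECTOR INVERSE `G_□(U)` OF THE SEQUENCE `{Ω_n(□)}` AT A CUBE PAIR** (letter (C)): the inverse of `Δ_{loc,□}[𝔮_□](U) − Pl_□(U)`
(`Pl_□ = DP_□D*`) compressed to the vector fields supported in `B = Ω₀(□)`, extended by `0` — the cube-pair twin of def-Y's `GDirBY`.
[cite: Balaban1985BackgroundPropagators, p.409 l.1–5 («G_□(U)»), (3.26)–(3.27) p.395, (3.87) p.409, (3.105) p.414] -/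
def GDirCY (𝔮c : QCLetterY 𝔸 i q) (𝔮cs : QCsLetterY 𝔸 i q) (Pl : CfgY 𝔸 i → Module.End ℂ (FBondY i → 𝔸)) (B : Finset (FBondY i)) : BondOpY 𝔸 i :=
  fun U => dirInvY (indProjY B) (deltaLocCQY i q 𝔮c 𝔮cs U - Pl U)

variable (𝔮c : QCLetterY 𝔸 i q) (𝔮cs : QCsLetterY 𝔸 i q)

/-- `G_□(U)`, unfolded. [cite: Balaban1985BackgroundPropagators, p.409 l.1–5, bookkeeping] -/
theorem GDirCY_def (Pl : CfgY 𝔸 i → Module.End ℂ (FBondY i → 𝔸)) (B : Finset (FBondY i)) (U : CfgY 𝔸 i) :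
    GDirCY i q 𝔮c 𝔮cs Pl B U = indProjY B * Ring.inverse (padDeltaLocCY i q 𝔮c 𝔮cs Pl B U) * indProjY B := rfl

/-- `G_□(U)` IS def-Y's generic Dirichlet local inverse at `T = Δ_{loc,□}[𝔮_□](U) − Pl_□(U)`. [cite: Balaban1985BackgroundPropagators, p.409 l.1–5, bookkeeping] -/
theorem GDirCY_apply_eq (Pl : CfgY 𝔸 i → Module.End ℂ (FBondY i → 𝔸)) (B : Finset (FBondY i)) (U : CfgY 𝔸 i) :
    GDirCY i q 𝔮c 𝔮cs Pl B U = dirInvY (indProjY B) (deltaLocCQY i q 𝔮c 𝔮cs U - Pl U) := rfl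

/-- the regime object, unfolded. [cite: Balaban1985BackgroundPropagators, p.409 l.1–5, bookkeeping] -/
theorem padDeltaLocCY_eq (Pl : CfgY 𝔸 i → Module.End ℂ (FBondY i → 𝔸)) (B : Finset (FBondY i)) (U : CfgY 𝔸 i) :
    padDeltaLocCY i q 𝔮c 𝔮cs Pl B U = dirPadY (indProjY B) (deltaLocCQY i q 𝔮c 𝔮cs U - Pl U) := rfl

/-- the straight-contour face of the letter: at r05's pair, `G_□(U) = dirInv_{𝟙_B}(Δ_{loc,□}(U) − Pl_□(U))` with `B9Eq3105AtLetters.deltaLocCubeY`.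
[cite: Balaban1985BackgroundPropagators, p.409 l.1–5, bookkeeping] -/
theorem GDirCY_QCubeY (parB : BondParY 𝔸 i) (Pl : CfgY 𝔸 i → Module.End ℂ (FBondY i → 𝔸)) (B : Finset (FBondY i)) (U : CfgY 𝔸 i) :
    GDirCY i q (QCubeY i q parB) (QsCubeY i q parB) Pl B U = dirInvY (indProjY B) (deltaLocCubeY i q parB U - Pl U) := rfl

/-- support on the left: `Ω₀ G_□ = G_□`. [cite: Balaban1985BackgroundPropagators, p.394 («Ω₀Δ′_aΩ₀»), p.409] -/
theorem indProjY_mul_GDirCY (Pl : CfgY 𝔸 i → Module.End ℂ (FBondY i → 𝔸)) (B : Finset (FBondY i)) (U : CfgY 𝔸 i) :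
    indProjY B * GDirCY i q 𝔮c 𝔮cs Pl B U = GDirCY i q 𝔮c 𝔮cs Pl B U :=
  indProjY_mul_dirInvY B _

/-- and on the right: `G_□ Ω₀ = G_□`. [cite: Balaban1985BackgroundPropagators, p.394, p.409] -/
theorem GDirCY_mul_indProjY (Pl : CfgY 𝔸 i → Module.End ℂ (FBondY i → 𝔸)) (B : Finset (FBondY i)) (U : CfgY 𝔸 i) :
    GDirCY i q 𝔮c 𝔮cs Pl B U * indProjY B = GDirCY i q 𝔮c 𝔮cs Pl B U :=
  dirInvY_mul_indProjY B _

/-- `G_□(U)A` vanishes off `B`. [cite: Balaban1985BackgroundPropagators, p.394 (Dirichlet boundary conditions), p.409] -/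
theorem GDirCY_apply_eq_zero (Pl : CfgY 𝔸 i → Module.End ℂ (FBondY i → 𝔸)) {B : Finset (FBondY i)} (U : CfgY 𝔸 i) (A : FBondY i → 𝔸)
    {b : FBondY i} (hb : b ∉ B) : GDirCY i q 𝔮c 𝔮cs Pl B U A b = 0 :=
  dirInvY_apply_eq_zero B _ A hb

/-- `G_□(U)A` depends on `A` only on `B`. [cite: Balaban1985BackgroundPropagators, p.394 (Dirichlet boundary conditions), p.409] -/
theorem GDirCY_apply_congr (Pl : CfgY 𝔸 i → Module.End ℂ (FBondY i → 𝔸)) {B : Finset (FBondY i)} (U : CfgY 𝔸 i) {A A' : FBondY i → 𝔸}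
    (h : ∀ b ∈ B, A b = A' b) : GDirCY i q 𝔮c 𝔮cs Pl B U A = GDirCY i q 𝔮c 𝔮cs Pl B U A' :=
  dirInvY_apply_congr B _ h

/-- off the unit locus the letter is `0`. [cite: Balaban1985BackgroundPropagators, Cor. 3.6 p.408 (the regime), bookkeeping] -/
theorem GDirCY_of_not_isUnit (Pl : CfgY 𝔸 i → Module.End ℂ (FBondY i → 𝔸)) {B : Finset (FBondY i)} {U : CfgY 𝔸 i}
    (hU : ¬ IsUnit (padDeltaLocCY i q 𝔮c 𝔮cs Pl B U)) : GDirCY i q 𝔮c 𝔮cs Pl B U = 0 :=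
  dirInvY_of_not_isUnit' B hU

/-- inverse law: `(Ω₀TΩ₀)·G_□ = Ω₀`, `T = Δ_{loc,□}[𝔮_□](U) − Pl_□(U)`. [cite: Balaban1985BackgroundPropagators, p.394, (3.88) p.409] -/
theorem compr_mul_GDirCY (Pl : CfgY 𝔸 i → Module.End ℂ (FBondY i → 𝔸)) {B : Finset (FBondY i)} {U : CfgY 𝔸 i}
    (hU : IsUnit (padDeltaLocCY i q 𝔮c 𝔮cs Pl B U)) :
    indProjY B * (deltaLocCQY i q 𝔮c 𝔮cs U - Pl U) * indProjY B * GDirCY i q 𝔮c 𝔮cs Pl B U = indProjY B :=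
  compr_mul_dirInvY' B hU

/-- inverse law: `G_□·(Ω₀TΩ₀) = Ω₀`. [cite: Balaban1985BackgroundPropagators, p.394, (3.88) p.409] -/
theorem GDirCY_mul_compr (Pl : CfgY 𝔸 i → Module.End ℂ (FBondY i → 𝔸)) {B : Finset (FBondY i)} {U : CfgY 𝔸 i}
    (hU : IsUnit (padDeltaLocCY i q 𝔮c 𝔮cs Pl B U)) :
    GDirCY i q 𝔮c 𝔮cs Pl B U * (indProjY B * (deltaLocCQY i q 𝔮c 𝔮cs U - Pl U) * indProjY B) = indProjY B :=
  dirInvY_mul_compr' B hU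

/-- inverse law: `Ω₀·T·G_□ = Ω₀`. [cite: Balaban1985BackgroundPropagators, p.394, (3.88) p.409] -/
theorem indProjY_mul_op_mul_GDirCY (Pl : CfgY 𝔸 i → Module.End ℂ (FBondY i → 𝔸)) {B : Finset (FBondY i)} {U : CfgY 𝔸 i}
    (hU : IsUnit (padDeltaLocCY i q 𝔮c 𝔮cs Pl B U)) :
    indProjY B * (deltaLocCQY i q 𝔮c 𝔮cs U - Pl U) * GDirCY i q 𝔮c 𝔮cs Pl B U = indProjY B :=
  indProjY_mul_op_mul_dirInvY B hU

/-- inverse law (transposed): `G_□·T·Ω₀ = Ω₀`. [cite: Balaban1985BackgroundPropagators, p.394, (3.88) p.409] -/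
theorem GDirCY_mul_op_mul_indProjY (Pl : CfgY 𝔸 i → Module.End ℂ (FBondY i → 𝔸)) {B : Finset (FBondY i)} {U : CfgY 𝔸 i}
    (hU : IsUnit (padDeltaLocCY i q 𝔮c 𝔮cs Pl B U)) :
    GDirCY i q 𝔮c 𝔮cs Pl B U * (deltaLocCQY i q 𝔮c 𝔮cs U - Pl U) * indProjY B = indProjY B :=
  dirInvY_mul_op_mul_indProjY B hU

/-- ★ the local-inverse law IN THE CUBE PAIR's OWN LETTER: `M_h(Δ_{loc,□}[𝔮_□](U) − Pl_□(U))G_□(U)M_h = M_h²` for a cut-off `h` whose bond reading is supported in `B`.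
[cite: Balaban1985BackgroundPropagators, (3.87)–(3.88) p.409, (3.105) p.414] -/
theorem hlocC_GDirCY (Pl : CfgY 𝔸 i → Module.End ℂ (FBondY i → 𝔸)) {B : Finset (FBondY i)} {U : CfgY 𝔸 i}
    (hU : IsUnit (padDeltaLocCY i q 𝔮c 𝔮cs Pl B U)) (h : SiteY i → ℝ) (hB : ∀ b, hBdY i h b ≠ 0 → b ∈ B) :
    cutMulY (hBdY i h) * (deltaLocCQY i q 𝔮c 𝔮cs U - Pl U) * GDirCY i q 𝔮c 𝔮cs Pl B U * cutMulY (hBdY i h) =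
      cutMulY (hBdY i h) * cutMulY (hBdY i h) :=
  cutMulY_op_dirInvY_cutMulY B hU (hBdY i h) hB

/-- ★ the transposed local-inverse law in the cube pair's own letter: `M_hG_□(U)(Δ_{loc,□}[𝔮_□](U) − Pl_□(U))M_h = M_h²`. (transposed reading — bookkeeping)
[cite: Balaban1985BackgroundPropagators, (3.87)–(3.88) p.409, (3.105) p.414] -/
theorem hlocTC_GDirCY (Pl : CfgY 𝔸 i → Module.End ℂ (FBondY i → 𝔸)) {B : Finset (FBondY i)} {U : CfgY 𝔸 i}
    (hU : IsUnit (padDeltaLocCY i q 𝔮c 𝔮cs Pl B U)) (h : SiteY i → ℝ) (hB : ∀ b, hBdY i h b ≠ 0 → b ∈ B) :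
    cutMulY (hBdY i h) * GDirCY i q 𝔮c 𝔮cs Pl B U * (deltaLocCQY i q 𝔮c 𝔮cs U - Pl U) * cutMulY (hBdY i h) =
      cutMulY (hBdY i h) * cutMulY (hBdY i h) :=
  cutMulY_dirInvY_op_cutMulY B hU (hBdY i h) hB

/-- ★★ **`hloc` IN THE MEMBER's LETTER, FROM ROW AGREEMENT**: if the averaging rows of the member's pair `(𝔮, 𝔮⋆)` and of the cube pair agree wherever
`h(f₋) ≠ 0`, then `M_h(Δ_loc[𝔮](U) − Pl_□(U))G_□(U)M_h = M_h²` — LITERALLY the hypothesis `hloc` of ✓`B9Eq3105OfLocalInverseQ.eq3105Q_hT_ofLocalInverse` at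
`Gl_□ := G_□(U)` keyed on the cube pair (print: `supp h_□ ⊂ □̃`, and the sequences `{Ω_j}`, `{Ω_n(□)}` have the same index bonds near □).
[cite: Balaban1985BackgroundPropagators, (3.87)–(3.88) p.409, p.409 l.1–5, (3.105) p.414 («Similarly for averaging operators»)] -/
theorem hloc_GDirCY_of_rows (𝔮 : QLetterY 𝔸 i) (𝔮s : QsLetterY 𝔸 i) (Pl : CfgY 𝔸 i → Module.End ℂ (FBondY i → 𝔸)) {B : Finset (FBondY i)}
    {U : CfgY 𝔸 i} (hU : IsUnit (padDeltaLocCY i q 𝔮c 𝔮cs Pl B U)) (h : SiteY i → ℝ) (hB : ∀ b, hBdY i h b ≠ 0 → b ∈ B)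
    (hrow : ∀ (A : FBondY i → 𝔸) (f : FBondY i), h (chartY i f.src) ≠ 0 → 𝔮s U (aY i (𝔮 U A)) f = 𝔮cs U (aCubeY i q (𝔮c U A)) f) :
    cutMulY (hBdY i h) * (deltaLocQY i 𝔮 𝔮s U - Pl U) * GDirCY i q 𝔮c 𝔮cs Pl B U * cutMulY (hBdY i h) =
      cutMulY (hBdY i h) * cutMulY (hBdY i h) := by
  rw [mul_sub, cutMulY_mul_deltaLocQY_eq_of_rows i q 𝔮c 𝔮cs 𝔮 𝔮s U h hrow, ← mul_sub]
  exact hlocC_GDirCY i q 𝔮c 𝔮cs Pl hU h hB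

/-- ★★ **`hlocT` IN THE MEMBER's LETTER, FROM COLUMN AGREEMENT**: `M_hG_□(U)(Δ_loc[𝔮](U) − Pl_□(U))M_h = M_h²` — the hypothesis `hlocT` of
✓`eq3105QT_hT_ofLocalInverse` at `Gl_□ := G_□(U)` keyed on the cube pair. (transposed reading — bookkeeping)
[cite: Balaban1985BackgroundPropagators, (3.87)–(3.88) p.409, p.409 l.1–5, (3.105) p.414] -/
theorem hlocT_GDirCY_of_cols (𝔮 : QLetterY 𝔸 i) (𝔮s : QsLetterY 𝔸 i) (Pl : CfgY 𝔸 i → Module.End ℂ (FBondY i → 𝔸)) {B : Finset (FBondY i)}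
    {U : CfgY 𝔸 i} (hU : IsUnit (padDeltaLocCY i q 𝔮c 𝔮cs Pl B U)) (h : SiteY i → ℝ) (hB : ∀ b, hBdY i h b ≠ 0 → b ∈ B)
    (hcol : ∀ (A : FBondY i → 𝔸) (f : FBondY i),
      𝔮s U (aY i (𝔮 U (cutMulY (hBdY i h) A))) f = 𝔮cs U (aCubeY i q (𝔮c U (cutMulY (hBdY i h) A))) f) :
    cutMulY (hBdY i h) * GDirCY i q 𝔮c 𝔮cs Pl B U * (deltaLocQY i 𝔮 𝔮s U - Pl U) * cutMulY (hBdY i h) =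
      cutMulY (hBdY i h) * cutMulY (hBdY i h) := by
  rw [mul_assoc _ _ (cutMulY (hBdY i h)), sub_mul, deltaLocQY_mul_cutMulY_eq_of_cols i q 𝔮c 𝔮cs 𝔮 𝔮s U h hcol, ← sub_mul, ← mul_assoc]
  exact hlocTC_GDirCY i q 𝔮c 𝔮cs Pl hU h hB

/-- LOCALITY IN `U`: `G_□(U)` reads `U` only through the compression `Ω₀(Δ_{loc,□}[𝔮_□](U) − Pl_□(U))Ω₀` on vector fields supported in `B`.
[cite: Balaban1985BackgroundPropagators, p.410 («G′_□(U), … depend on U restricted to Ω₀(□)»), p.394] -/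
theorem GDirCY_congr_of_apply (Pl : CfgY 𝔸 i → Module.End ℂ (FBondY i → 𝔸)) (B : Finset (FBondY i)) {U V : CfgY 𝔸 i}
    (h : ∀ A : FBondY i → 𝔸, (∀ b, b ∉ B → A b = 0) → ∀ b ∈ B,
      (deltaLocCQY i q 𝔮c 𝔮cs U - Pl U) A b = (deltaLocCQY i q 𝔮c 𝔮cs V - Pl V) A b) :
    GDirCY i q 𝔮c 𝔮cs Pl B U = GDirCY i q 𝔮c 𝔮cs Pl B V :=
  dirInvY_congr_of_apply B h

/-- the same from agreement of the compressions. [cite: Balaban1985BackgroundPropagators, p.410, p.394, bookkeeping] -/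
theorem GDirCY_congr (Pl : CfgY 𝔸 i → Module.End ℂ (FBondY i → 𝔸)) (B : Finset (FBondY i)) {U V : CfgY 𝔸 i}
    (h : indProjY B * (deltaLocCQY i q 𝔮c 𝔮cs U - Pl U) * indProjY B = indProjY B * (deltaLocCQY i q 𝔮c 𝔮cs V - Pl V) * indProjY B) :
    GDirCY i q 𝔮c 𝔮cs Pl B U = GDirCY i q 𝔮c 𝔮cs Pl B V :=
  dirInvY_congr h

/-- and the regime object is local in the same sense. [cite: Balaban1985BackgroundPropagators, p.410, p.394, bookkeeping] -/
theorem padDeltaLocCY_congr_of_apply (Pl : CfgY 𝔸 i → Module.End ℂ (FBondY i → 𝔸)) (B : Finset (FBondY i)) {U V : CfgY 𝔸 i}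
    (h : ∀ A : FBondY i → 𝔸, (∀ b, b ∉ B → A b = 0) → ∀ b ∈ B,
      (deltaLocCQY i q 𝔮c 𝔮cs U - Pl U) A b = (deltaLocCQY i q 𝔮c 𝔮cs V - Pl V) A b) :
    padDeltaLocCY i q 𝔮c 𝔮cs Pl B U = padDeltaLocCY i q 𝔮c 𝔮cs Pl B V :=
  dirPadY_congr_of_apply B h

end Letter

/-! ## §3 (3.105) and its transpose at the member's `Δ_a[𝔮][G′](U)` with `G_□(U)` at the cube pairs -/

section Eq3105

variable (i : KIdx d ℓ hd hL b₀ b₁) (𝔮 : QLetterY 𝔸 i) (𝔮s : QsLetterY 𝔸 i)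

/-- ★★★ **(3.105) AT THE MEMBER's `Δ_a[𝔮][G′](U)` WITH PRINT's `G_□(U)` OF THE CUBE SEQUENCES** (a cube-indexed family of cube pairs `(𝔮_□, 𝔮⋆_□)`, projection
letters `Pl_□` with their (3.101) rows `hP1`, bond sets `B_□ ⊇ supp h_□`, cut-offs `ζ_□̃ = 1` on `supp h_□`), `E_□ ≡ 0`:
`Δ_a(U)·Σ_□ h_□G_□(U)h_□ = 1 − Σ_□K(h_□)G_□h_□ − Σ_□(1 − ζ_□̃)DPD*(h_□G_□h_□) − Σ_□ζ_□̃(DPD* − Pl_□)(h_□G_□h_□) − Σ_□ζ_□̃P_{l,1}(∂h_□)G_□h_□` — def-Y's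
✓`eq3105Q_hT_ofLocalInverse` with `hloc` DISCHARGED by `hloc_GDirCY_of_rows` (regime + row agreement on `supp h_□`, displayed).
[cite: Balaban1985BackgroundPropagators, (3.105) p.414, p.409 l.1–5, (3.87) p.409, Cor. 3.6 p.408] -/
theorem eq3105Q_hT_GDirCY (parS : SiteParY 𝔸 i) (Gp : SiteOpY 𝔸 i) (U : CfgY 𝔸 i)
    (ζ : ↥(cubes i.D.toDomains) → SiteY i → ℝ) (hζ : ∀ c z, hTY i c z ≠ 0 → ζ c z = 1)
    (𝔮c : ∀ c : ↥(cubes (toKT i).D.toDomains), QCLetterY 𝔸 i c) (𝔮cs : ∀ c : ↥(cubes (toKT i).D.toDomains), QCsLetterY 𝔸 i c)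
    (Pl : ↥(cubes i.D.toDomains) → CfgY 𝔸 i → Module.End ℂ (FBondY i → 𝔸)) (P1l : ↥(cubes i.D.toDomains) → Module.End ℂ (FBondY i → 𝔸))
    (hP1 : ∀ c, Pl c U * cutMulY (hBdY i (hTY i c)) = cutMulY (hBdY i (hTY i c)) * Pl c U + P1l c)
    (B : ↥(cubes i.D.toDomains) → Finset (FBondY i)) (hB : ∀ c b, hBdY i (hTY i c) b ≠ 0 → b ∈ B c)
    (hU : ∀ c, IsUnit (padDeltaLocCY i c (𝔮c c) (𝔮cs c) (Pl c) (B c) U))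
    (hrow : ∀ c (A : FBondY i → 𝔸) (f : FBondY i), hTY i c (chartY i f.src) ≠ 0 →
      𝔮s U (aY i (𝔮 U A)) f = 𝔮cs c U (aCubeY i c (𝔮c c U A)) f) :
    deltaAQY i 𝔮 𝔮s parS Gp U * ∑ c, cutMulY (hBdY i (hTY i c)) * GDirCY i c (𝔮c c) (𝔮cs c) (Pl c) (B c) U * cutMulY (hBdY i (hTY i c)) =
      1 - ∑ c, KhBQY i (hTY i c) 𝔮 𝔮s U * GDirCY i c (𝔮c c) (𝔮cs c) (Pl c) (B c) U * cutMulY (hBdY i (hTY i c))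
        - ∑ c, (1 - cutMulY (hBdY i (ζ c))) * DPDsY i parS Gp U *
            (cutMulY (hBdY i (hTY i c)) * GDirCY i c (𝔮c c) (𝔮cs c) (Pl c) (B c) U * cutMulY (hBdY i (hTY i c)))
        - ∑ c, cutMulY (hBdY i (ζ c)) * (DPDsY i parS Gp U - Pl c U) *
            (cutMulY (hBdY i (hTY i c)) * GDirCY i c (𝔮c c) (𝔮cs c) (Pl c) (B c) U * cutMulY (hBdY i (hTY i c)))
        - ∑ c, cutMulY (hBdY i (ζ c)) * P1l c * GDirCY i c (𝔮c c) (𝔮cs c) (Pl c) (B c) U * cutMulY (hBdY i (hTY i c)) :=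
  eq3105Q_hT_ofLocalInverse i 𝔮 𝔮s parS Gp U ζ hζ (fun c => GDirCY i c (𝔮c c) (𝔮cs c) (Pl c) (B c) U) (fun c => Pl c U) P1l hP1
    fun c => hloc_GDirCY_of_rows i c (𝔮c c) (𝔮cs c) 𝔮 𝔮s (Pl c) (hU c) (hTY i c) (hB c) (hrow c)

/-- ★★★ **THE TRANSPOSE OF (3.105) AT THE MEMBER's `Δ_a[𝔮][G′](U)` WITH `G_□(U)` OF THE CUBE SEQUENCES**, `E♯_□ ≡ 0` (✓`eq3105QT_hT_ofLocalInverse` with `hlocT`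
discharged by `hlocT_GDirCY_of_cols`). (transposed reading — bookkeeping; print displays only the left form of (3.105))
[cite: Balaban1985BackgroundPropagators, (3.105) p.414, p.409 l.1–5, (3.87) p.409, Cor. 3.6 p.408] -/
theorem eq3105QT_hT_GDirCY (parS : SiteParY 𝔸 i) (Gp : SiteOpY 𝔸 i) (U : CfgY 𝔸 i)
    (ζ : ↥(cubes i.D.toDomains) → SiteY i → ℝ) (hζ : ∀ c z, hTY i c z ≠ 0 → ζ c z = 1)
    (𝔮c : ∀ c : ↥(cubes (toKT i).D.toDomains), QCLetterY 𝔸 i c) (𝔮cs : ∀ c : ↥(cubes (toKT i).D.toDomains), QCsLetterY 𝔸 i c)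
    (Pl : ↥(cubes i.D.toDomains) → CfgY 𝔸 i → Module.End ℂ (FBondY i → 𝔸)) (P1l : ↥(cubes i.D.toDomains) → Module.End ℂ (FBondY i → 𝔸))
    (hP1 : ∀ c, Pl c U * cutMulY (hBdY i (hTY i c)) = cutMulY (hBdY i (hTY i c)) * Pl c U + P1l c)
    (B : ↥(cubes i.D.toDomains) → Finset (FBondY i)) (hB : ∀ c b, hBdY i (hTY i c) b ≠ 0 → b ∈ B c)
    (hU : ∀ c, IsUnit (padDeltaLocCY i c (𝔮c c) (𝔮cs c) (Pl c) (B c) U))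
    (hcol : ∀ c (A : FBondY i → 𝔸) (f : FBondY i),
      𝔮s U (aY i (𝔮 U (cutMulY (hBdY i (hTY i c)) A))) f = 𝔮cs c U (aCubeY i c (𝔮c c U (cutMulY (hBdY i (hTY i c)) A))) f) :
    (∑ c, cutMulY (hBdY i (hTY i c)) * GDirCY i c (𝔮c c) (𝔮cs c) (Pl c) (B c) U * cutMulY (hBdY i (hTY i c))) * deltaAQY i 𝔮 𝔮s parS Gp U =
      1 + ∑ c, cutMulY (hBdY i (hTY i c)) * GDirCY i c (𝔮c c) (𝔮cs c) (Pl c) (B c) U * KhBQY i (hTY i c) 𝔮 𝔮s U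
        + ∑ c, cutMulY (hBdY i (hTY i c)) * GDirCY i c (𝔮c c) (𝔮cs c) (Pl c) (B c) U * P1l c
        - ∑ c, cutMulY (hBdY i (hTY i c)) * GDirCY i c (𝔮c c) (𝔮cs c) (Pl c) (B c) U * cutMulY (hBdY i (hTY i c)) *
            (cutMulY (hBdY i (ζ c)) * (DPDsY i parS Gp U - Pl c U))
        - ∑ c, cutMulY (hBdY i (hTY i c)) * GDirCY i c (𝔮c c) (𝔮cs c) (Pl c) (B c) U * cutMulY (hBdY i (hTY i c)) *
            ((1 - cutMulY (hBdY i (ζ c))) * DPDsY i parS Gp U) :=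
  eq3105QT_hT_ofLocalInverse i 𝔮 𝔮s parS Gp U ζ hζ (fun c => GDirCY i c (𝔮c c) (𝔮cs c) (Pl c) (B c) U) (fun c => Pl c U) P1l hP1
    fun c => hlocT_GDirCY_of_cols i c (𝔮c c) (𝔮cs c) 𝔮 𝔮s (Pl c) (hU c) (hTY i c) (hB c) (hcol c)

end Eq3105

/-! ## §4 The `U = 1` face at a pair with flat faces `𝔮_□(1) = q_□♯`, `𝔮⋆_□(1) = q*_□♯` -/

section Flat

variable (i : KIdx d ℓ hd hL b₀ b₁) {q : ↥(cubes (toKT i).D.toDomains)} (𝔮c : QCLetterY 𝔸 i q) (𝔮cs : QCsLetterY 𝔸 i q)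

/-- ★ **`Δ_{loc,□}[𝔮_□](1) = (deltaLocCubeMatY i □)♯`** at a pair with flat `U = 1` faces (dag-n06-j's matrix `∂ᶜ*∂ᶜ + ∂∂* + q*_□a_□q_□`; via the straight pair at the
trivial transporter, ✓`deltaLocCubeY_one_liftMatY`). [cite: Balaban1985BackgroundPropagators, p.395 («coincides with Δ_a in (2.19) if U = 1»), p.409 l.1–5; Balaban1984PropagatorsII, (2.19) p.227] -/
theorem deltaLocCQY_one_liftMatY (h1 : 𝔮c (fun _ _ => 1) = liftMatY 𝔸 (qKc i q)) (h1s : 𝔮cs (fun _ _ => 1) = liftMatY 𝔸 (qsKc i q)) :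
    deltaLocCQY i q 𝔮c 𝔮cs (fun _ _ => 1) = liftMatY 𝔸 (deltaLocCubeMatY i q) := by
  rw [← deltaLocCubeY_one_liftMatY i (q := q) (parB := fun _ _ _ => 1) (fun _ _ => rfl), ← deltaLocCQY_QCubeY, deltaLocCQY, deltaLocCQY,
    QCubeY_one i q (parB := fun _ _ _ => 1) (fun _ _ => rfl), QsCubeY_one i q (parB := fun _ _ _ => 1) (fun _ _ => rfl), h1, h1s]

/-- ★★ **THE `hT1`-SHAPE READING AT THE CUBE PAIR**: `Δ_{loc,□}[𝔮_□](1) − DP_□(1)D* = (mlocDirCMatY i □ S K K_X)♯` (def-Y's `DPDsDirCubeY … S` at `U = 1`, dag-n06-j ✓§5),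
under the two displayed inverse sockets `hK` (sites of `S`) and `hKX` (blocks inside `S`). [cite: Balaban1985BackgroundPropagators, p.395, (3.25)–(3.26) pp.394–395, p.409 l.1–5, Cor. 3.5 p.407] -/
theorem deltaLocCQY_sub_DPDsDirCubeY_one (h1 : 𝔮c (fun _ _ => 1) = liftMatY 𝔸 (qKc i q)) (h1s : 𝔮cs (fun _ _ => 1) = liftMatY 𝔸 (qsKc i q))
    (S : Finset (SiteY i)) {K : Matrix (SiteY i) (SiteY i) ℝ}
    (hK : (mlOpT (toKT i).NB ℓ (toKT i).k (cubeFamY i q).lev (wCube ℓ)).submatrix (fun v : ↥S => (v : SiteY i)) (fun v : ↥S => (v : SiteY i)) *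
      K.submatrix (fun v : ↥S => (v : SiteY i)) (fun v : ↥S => (v : SiteY i)) = 1)
    {KX : Matrix (BlkCubeY i q) (BlkCubeY i q) ℝ}
    (hKX : (xDirMatY i q S K).submatrix (fun v : ↥(insideBlkY i q S) => (v : BlkCubeY i q)) (fun v : ↥(insideBlkY i q S) => (v : BlkCubeY i q)) *
      KX.submatrix (fun v : ↥(insideBlkY i q S) => (v : BlkCubeY i q)) (fun v : ↥(insideBlkY i q S) => (v : BlkCubeY i q)) = 1) :
    deltaLocCQY i q 𝔮c 𝔮cs (fun _ _ => 1) - DPDsDirCubeY i q S (fun _ _ => 1) = liftOpY 𝔸 (mlocDirCMatY i q S K KX) := by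
  rw [deltaLocCQY_one_liftMatY i 𝔮c 𝔮cs h1 h1s, DPDsDirCubeY_one_liftMatY i S hK hKX, mlocDirCMatY, liftOpY_eq_liftMatY, liftMatY_sub]

/-- ★ **THE REGIME AT `U = 1`** from a compressed real inverse `K_B` of `mlocDirCMatY i □ S K K_X` on the bond set `B`: `padDeltaLocCY … 1` is a unit.
[cite: Balaban1985BackgroundPropagators, p.395 («if U = 1»), Cor. 3.5 p.407, p.409 l.1–5; Balaban1983RegularityDecay, (2.42) p.584] -/
theorem isUnit_padDeltaLocCY_one (h1 : 𝔮c (fun _ _ => 1) = liftMatY 𝔸 (qKc i q)) (h1s : 𝔮cs (fun _ _ => 1) = liftMatY 𝔸 (qsKc i q))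
    (S : Finset (SiteY i)) {K : Matrix (SiteY i) (SiteY i) ℝ}
    (hK : (mlOpT (toKT i).NB ℓ (toKT i).k (cubeFamY i q).lev (wCube ℓ)).submatrix (fun v : ↥S => (v : SiteY i)) (fun v : ↥S => (v : SiteY i)) *
      K.submatrix (fun v : ↥S => (v : SiteY i)) (fun v : ↥S => (v : SiteY i)) = 1)
    {KX : Matrix (BlkCubeY i q) (BlkCubeY i q) ℝ}
    (hKX : (xDirMatY i q S K).submatrix (fun v : ↥(insideBlkY i q S) => (v : BlkCubeY i q)) (fun v : ↥(insideBlkY i q S) => (v : BlkCubeY i q)) *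
      KX.submatrix (fun v : ↥(insideBlkY i q S) => (v : BlkCubeY i q)) (fun v : ↥(insideBlkY i q S) => (v : BlkCubeY i q)) = 1)
    (B : Finset (FBondY i)) {KB : Matrix (FBondY i) (FBondY i) ℝ}
    (hKB : (mlocDirCMatY i q S K KX).submatrix (fun v : ↥B => (v : FBondY i)) (fun v : ↥B => (v : FBondY i)) *
      KB.submatrix (fun v : ↥B => (v : FBondY i)) (fun v : ↥B => (v : FBondY i)) = 1) :
    IsUnit (padDeltaLocCY i q 𝔮c 𝔮cs (DPDsDirCubeY i q S) B (fun _ _ => (1 : 𝔸ˣ))) := by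
  rw [padDeltaLocCY_eq, deltaLocCQY_sub_DPDsDirCubeY_one i 𝔮c 𝔮cs h1 h1s S hK hKX]
  exact isUnit_dirPadY_indProjY_liftOpY B hKB

/-- ★★ **THE `U = 1` CLAUSE FOR `G_□`**: under the same readings, `G_□(1) = (𝟙_B K_B 𝟙_B)♯` — the socket the `U = 1` Dirichlet bond kernel rows plug into.
[cite: Balaban1985BackgroundPropagators, p.395 («if U = 1»), Cor. 3.5 p.407, p.409 l.1–5; Balaban1983RegularityDecay, (2.42) p.584] -/
theorem GDirCY_one_eq_liftOpY (h1 : 𝔮c (fun _ _ => 1) = liftMatY 𝔸 (qKc i q)) (h1s : 𝔮cs (fun _ _ => 1) = liftMatY 𝔸 (qsKc i q))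
    (S : Finset (SiteY i)) {K : Matrix (SiteY i) (SiteY i) ℝ}
    (hK : (mlOpT (toKT i).NB ℓ (toKT i).k (cubeFamY i q).lev (wCube ℓ)).submatrix (fun v : ↥S => (v : SiteY i)) (fun v : ↥S => (v : SiteY i)) *
      K.submatrix (fun v : ↥S => (v : SiteY i)) (fun v : ↥S => (v : SiteY i)) = 1)
    {KX : Matrix (BlkCubeY i q) (BlkCubeY i q) ℝ}
    (hKX : (xDirMatY i q S K).submatrix (fun v : ↥(insideBlkY i q S) => (v : BlkCubeY i q)) (fun v : ↥(insideBlkY i q S) => (v : BlkCubeY i q)) *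
      KX.submatrix (fun v : ↥(insideBlkY i q S) => (v : BlkCubeY i q)) (fun v : ↥(insideBlkY i q S) => (v : BlkCubeY i q)) = 1)
    (B : Finset (FBondY i)) {KB : Matrix (FBondY i) (FBondY i) ℝ}
    (hKB : (mlocDirCMatY i q S K KX).submatrix (fun v : ↥B => (v : FBondY i)) (fun v : ↥B => (v : FBondY i)) *
      KB.submatrix (fun v : ↥B => (v : FBondY i)) (fun v : ↥B => (v : FBondY i)) = 1) :
    GDirCY i q 𝔮c 𝔮cs (DPDsDirCubeY i q S) B (fun _ _ => 1) = liftOpY 𝔸 (indDiagY B * KB * indDiagY B) := by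
  rw [GDirCY_apply_eq, deltaLocCQY_sub_DPDsDirCubeY_one i 𝔮c 𝔮cs h1 h1s S hK hKX]
  exact dirInvY_indProjY_liftOpY B hKB

/-- its product-form reading: `G_□(1)(f ⊗ E)(b) = (Σ_{b′∈B} K_B b b′ f b′) E` on `B`, `0` off `B`.
[cite: Balaban1985BackgroundPropagators, p.395, p.409 l.1–5; Balaban1983RegularityDecay, (2.42) p.584] -/
theorem GDirCY_one_liftY_apply (h1 : 𝔮c (fun _ _ => 1) = liftMatY 𝔸 (qKc i q)) (h1s : 𝔮cs (fun _ _ => 1) = liftMatY 𝔸 (qsKc i q))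
    (S : Finset (SiteY i)) {K : Matrix (SiteY i) (SiteY i) ℝ}
    (hK : (mlOpT (toKT i).NB ℓ (toKT i).k (cubeFamY i q).lev (wCube ℓ)).submatrix (fun v : ↥S => (v : SiteY i)) (fun v : ↥S => (v : SiteY i)) *
      K.submatrix (fun v : ↥S => (v : SiteY i)) (fun v : ↥S => (v : SiteY i)) = 1)
    {KX : Matrix (BlkCubeY i q) (BlkCubeY i q) ℝ}
    (hKX : (xDirMatY i q S K).submatrix (fun v : ↥(insideBlkY i q S) => (v : BlkCubeY i q)) (fun v : ↥(insideBlkY i q S) => (v : BlkCubeY i q)) *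
      KX.submatrix (fun v : ↥(insideBlkY i q S) => (v : BlkCubeY i q)) (fun v : ↥(insideBlkY i q S) => (v : BlkCubeY i q)) = 1)
    (B : Finset (FBondY i)) {KB : Matrix (FBondY i) (FBondY i) ℝ}
    (hKB : (mlocDirCMatY i q S K KX).submatrix (fun v : ↥B => (v : FBondY i)) (fun v : ↥B => (v : FBondY i)) *
      KB.submatrix (fun v : ↥B => (v : FBondY i)) (fun v : ↥B => (v : FBondY i)) = 1)
    (f : FBondY i → ℝ) (E : 𝔸) (b : FBondY i) :
    GDirCY i q 𝔮c 𝔮cs (DPDsDirCubeY i q S) B (fun _ _ => 1) (liftY f E) b = if b ∈ B then (((∑ b' ∈ B, KB b b' * f b' : ℝ)) : ℂ) • E else 0 := by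
  rw [GDirCY_one_eq_liftOpY i 𝔮c 𝔮cs h1 h1s S hK hKX B hKB, liftOpY_liftY, liftY_apply, compr_mulVec_apply]
  split_ifs <;> simp

end Flat

end Literature.MathematicalPhysics.QuantumFieldTheory.Balaban1983to89.B9DirichletBondCubePairY

end
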